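import Literature.MathematicalPhysics.QuantumFieldTheory.Balaban1983to89.Node00.N24ItemsStage13AtThm1CCMWOfStepRSignFreeAllTorusSepCoPH
import Literature.MathematicalPhysics.QuantumFieldTheory.Balaban1983to89.B14NodeKnitRecord13RCoPH
import Summits.QuantumFields.YangMills.Theorems.BalabanUVNodesN13UVRowOfU1U2L2SmallLocus
import Summits.QuantumFields.YangMills.Theorems.BalabanUVNodesN13Cor3AtRecordOfDepthIndexedLeaves
import Summits.QuantumFields.YangMills.Theorems.BalabanUVNodesN07ExistenceFromProp8AtRadius

/-!
# NODE N24 (B2) — N07's TYPE `h07`, N11's (S1ᵀ) TYPE `h11` AND N13's (UV₁₃) TYPE `hUV` OF THE SPLIT CLOSERS (Parts 23∕24∕26∕27) SUPPLIED BY NAME IN PRINT's WORDS: `h11` ⟸ [III]'s THEOREM OF p. 245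
# along every run of the witness's datum (sequence reading, and AS PRINTED `B14.ThmP245PrintedI` for any 𝐓-family agreeing with the tower — dag-n11's `B14NodeKnitRecord13RCoPH` dictionary);
# `hUV` ⟸ dag-n13-w1's two sockets of record (depth-blind p597573 ∕ depth-indexed p601572) reading [III] Cor. 3's leaves (U1) ∕ (U2) ∕ (L2ˢ); `h07` (θ-free) ⟸ dag-n07's existence theorem at
# print's own radius ([B11] Props 2–9 + Sect. F + uniqueness + boundary avoidance, §5) — general `N`, door letters fixed

TRACK A (YM-PLAN §2d, node N24 of 28 = binder B2), seat `pub-ymgap-dag-n24-c` (R134 fan-out seat, strategy s2; gen 9, Part 28).  Key of record: K1⁷ `StabilityBAtRecordR13SepCoPH` =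
stmt-QuantumFields-20542; this file `--supports` it as a helper (Summits lane).
WHY (N11).  The split closers key N11 on `h11 : ∀ βup β₀, ∃ γ₁₁ > 0, ∀ w bound to the door's datum with those letters and `w.γ ≤ γ₁₁`, ∀ P, b7 → … → flowControl → ∀ k < K,
SLaw₁₃CoPH θᴴ P k → TLaw₁₃CoPH θᴴ P k`.  Its CONTENT is [III]'s Theorem of p. 245 at the record: §1 `N24_h11_theta13OfThm1CCMW_of_thmP245_laws` takes it in the SEQUENCE reading `∀ P, ∀ k < K,
SLaw → TLaw` (the world, its letters and the leaf antecedents UNREAD — `γ₁₁ := 1`); §2 `N24_h11_theta13OfThm1CCMW_of_thmP245PrintedI` takes it AS PRINTED, `B14.ThmP245PrintedI (T P) ρ S Scorr K` for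
ANY family `T P` of renormalization transformations on the run's lattices agreeing with the tower of record on the trajectory (`(T P k).T ρ_k = 𝐓ρ_k`), through dag-n11's dictionary
`B14NodeKnitRecord13RCoPH.thmP245PrintedI_at_record₁₃CoPH_iff_laws`.  The T-step SUPPLY that proves Theorem p.245 at the record ([III] §3) is dag-n11-e∕w3's chain (`SupplierObligations`,
`…Sect3SupplyChain*`), displayed there, not here.
WHY (N13).  The split closers key N13 on the TYPE `hUV : ∃ γ₁₃ > 0, ∃ em ep, ∀ P, (genFlow (β₁₃ θ) P.g0).InInterval γ₁₃ P.K → ∀ k ≤ P.K, SLaw₁₃CoPH θᴴ P k → ∀ U, (sandwich with e₋ := em, e₊ := ep)` at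
the witness `θ = θ₁₅ᶜᶜᴹᵂ(j; γ; …)`.  N13's sockets (dag-n13-w1 `N24-SUPPLIER N13`, I.28191) deliver that sandwich AT ANY WORLD `w` (only `w.γ`, `w.em`, `w.ep` — and, depth-indexed, `w.b` — are
read) from Cor. 3's leaves (U1) majorisation of every history term, (U2) the sum of the majorants under `exp(e₊(g_k)·|T_k|)`, (L2ˢ) the lower envelope ON THE SMALL LOCUS, at `θ`'s core
provisos and `εreg` in [Av] Prop. 2's range.  THIS FILE instantiates both at the door over the witness: the world binder becomes `w₁₃ : WorldP` (ANY world carrying N13's window `0 < w₁₃.γ` and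
exponent functions; N24 reads `γ₁₃ := w₁₃.γ`, `em := w₁₃.em`, `ep := w₁₃.ep`), `0 < εreg` is the door's `ha₀` (`θ₁₅ᶜᶜᴹᵂ.ν.εreg = a₀`, `rfl`), and the two [Av]-range numerics on `a₀` stay
displayed.  §1 depth-blind; §2 depth-indexed (budgets `Em Ep (g_k, K−k)` dominated by `w₁₃.em∕ep` while `(K−k)·w₁₃.b < g_k⁻²` — reads NODE O's floor `hlo : BetaLowerH w₁₃.b w₁₃.γ (β₁₃ θ)`,
DISPLAYED: on Part 23's road it is `hO`'s letter pair at `(w₁₃.b, w₁₃.γ)`).  A NEW importing module (imports Part 14 + dag-n11's `B14NodeKnitRecord13RCoPH` + the two N13 sockets + dag-n07's `…N07ExistenceFromProp8AtRadius`).  THEOREMS ONLY, def-free, sorry-free, standard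
axioms; each proof is ONE application.

HONEST FRAMING: composition BY NAME; nothing of Bałaban's asserted — Theorem p.245, Cor. 3's leaves and [B11] Props 2–9 ∕ Sect. F are DISPLAYED; N07 ∕ N11 ∕ N13 NOT discharged; K0⁷ ∕ K1⁷ NOT closed; N24 COMPOSITE — no
discharge, no count moved (5∕27 · A 5∕28); one finite 𝕋⁴ programme at fixed ε; R4 = the conditional finite-𝕋⁴ rung `BalabanLadder.UV` only — NOT continuum ∕ ℝ⁴ ∕ OS ∕ mass gap ∕ Clay.
-/

noncomputable section

open scoped Matrix.Norms.L2Operator BigOperators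

namespace Summit.QuantumFields.YangMills.BalabanUVNodes.N24ChildrenSplitN07N11N13Suppliers

open Literature.MathematicalPhysics.QuantumFieldTheory.Balaban1983to89
open Literature.MathematicalPhysics.QuantumFieldTheory.Balaban1983to89.Node00
open DagBinding T4Continuum T4DatumAssembly FlowStepRuns AveragingRT
open FlowStep (BetaLowerH BetaUpperH)
open ExpMeanLog (deltaSU)
open B14NodeKnitRecord13RCoPH (thmP245PrintedI_at_record₁₃CoPH_iff_laws)
open Summit.QuantumFields.YangMills.BalabanUVNodes.N13UVRowOfU1U2L2SmallLocus (hUV₁₃CoPH_of_U1_U2_L2small)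
open Summit.QuantumFields.YangMills.BalabanUVNodes.N13Cor3AtRecordOfDepthIndexedLeaves (hUV₁₃CoPH_of_U1_U2_L2small_depthIndexed)
open Summit.QuantumFields.YangMills.BalabanUVNodes.N07ExistenceFromProp8AtRadius (b11Leaf_Z11OfRecord_pinCrit_of_parts_atMostOne_prop8At_avoidanceAt)
open B12GaugeOrbits021 (OrbitRel)

variable {F : T4Family} {N : ℕ} [NeZero N]

/-! ## §1–§2. N11's TYPE `h11` from [III]'s Theorem of p. 245 at the witness's record (sequence reading; AS PRINTED for an agreeing 𝐓-family) -/

/-- **★ N11's TYPE `h11` OF THE SPLIT CLOSERS AT THE WITNESS FROM THE THEOREM OF p. 245 IN THE SEQUENCE READING** — `hT : ∀ P, ∀ k < P.K, SLaw₁₃CoPH θᴴ P k → TLaw₁₃CoPH θᴴ P k` along every run of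
the witness's datum (dag-n11 `B14NodeKnitRecord13RCoPH.thmP245_at_record₁₃CoPH_iff_laws` is the dictionary with [III]'s spaces of record); the world, its letters `(βup, β₀, γ)` and the leaf
antecedents are NOT read (`γ₁₁ := 1`).  CONDITIONAL; N11 NOT discharged; K1⁷ NOT closed. [cite: Balaban1988Convergent, Theorem p.245, Thm 1 p.262, remark p.262, (3.24)–(3.25) p.270; Balaban1989LargeFieldII, Thm 1 p.355 (bookkeeping)] -/
theorem N24_h11_theta13OfThm1CCMW_of_thmP245_laws {j c : ℕ} {γ ε₀ ε₂₉ B₃ B₃' a₀ a₁ : ℝ} (hγ₀ : 0 < γ) (hγh : γ ≤ 1 / 2)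
    (hε : 0 < ε₀) (hε' : 0 < ε₂₉) (hB : 0 ≤ B₃) (hB' : 0 ≤ B₃') (ha₀ : 0 < a₀) (ha₁ : 0 < a₁)
    (h15 : VariationalThm1RegSepCoP7M F N B₃ a₀ a₁) (hc : c ≤ F.L ^ j)
    (h9 : Gauge9RegSepTopStepR F N (fun ν K Ω => suppDomOfRecord F ν K Ω) (F.L ^ j) c B₃ B₃' a₀ a₁)
    {bl β' : ℝ} (hbox : BetaLowerH bl γ (betaOfRecord₁₃ F N (theta13OfThm1CCMW F N j γ ε₀ ε₂₉ B₃ B₃' a₀ a₁)))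
    (hbox' : BetaUpperH β' γ (betaOfRecord₁₃ F N (theta13OfThm1CCMW F N j γ ε₀ ε₂₉ B₃ B₃' a₀ a₁))) (hl : -bl * γ ^ 2 ≤ 3) (hβ' : β' * γ ^ 2 ≤ 3 / 4)
    (hT : ∀ (P : B12.RunParams) (k : ℕ), k < P.K → SLaw₁₃CoPH F N (Stage13HParams.ofHistoryBlind F N ⟨theta13OfThm1CCMW F N j γ ε₀ ε₂₉ B₃ B₃' a₀ a₁, ZrOfRecord₁₃ F N (theta13OfThm1CCMW F N j γ ε₀ ε₂₉ B₃ B₃' a₀ a₁)⟩) P k → TLaw₁₃CoPH F N (Stage13HParams.ofHistoryBlind F N ⟨theta13OfThm1CCMW F N j γ ε₀ ε₂₉ B₃ B₃' a₀ a₁, ZrOfRecord₁₃ F N (theta13OfThm1CCMW F N j γ ε₀ ε₂₉ B₃ B₃' a₀ a₁)⟩) P k) :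
    ∀ βup β₀ : ℝ, ∃ γ₁₁ : ℝ, 0 < γ₁₁ ∧ ∀ w : WorldP, w.C = (datumOfRecord₁₃SepCoPH F N (Stage13HParams.ofHistoryBlind F N ⟨theta13OfThm1CCMW F N j γ ε₀ ε₂₉ B₃ B₃' a₀ a₁, ZrOfRecord₁₃ F N (theta13OfThm1CCMW F N j γ ε₀ ε₂₉ B₃ B₃' a₀ a₁)⟩) (N24_provisos₁₃SepCoPH_door_theta13OfThm1CCMW_of_gauge9TopStepR_of_betaBoxSignFree_allTorus hγ₀ hγh hε hε' hB hB' ha₀ ha₁ h15 hc h9 hbox hbox' hl hβ')).C →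
      w.βup = βup → w.β₀ = β₀ → w.γ ≤ γ₁₁ → ∀ P : B12.RunParams, (leavesP w P).b7 → (leavesP w P).b8 → (leavesP w P).b9 → (leavesP w P).b10 → (leavesP w P).b11 →
      (leavesP w P).smallCouplings → (leavesP w P).smallFieldInductive → (leavesP w P).flowControl →
        ∀ k, k < P.K → SLaw₁₃CoPH F N (Stage13HParams.ofHistoryBlind F N ⟨theta13OfThm1CCMW F N j γ ε₀ ε₂₉ B₃ B₃' a₀ a₁, ZrOfRecord₁₃ F N (theta13OfThm1CCMW F N j γ ε₀ ε₂₉ B₃ B₃' a₀ a₁)⟩) P k → TLaw₁₃CoPH F N (Stage13HParams.ofHistoryBlind F N ⟨theta13OfThm1CCMW F N j γ ε₀ ε₂₉ B₃ B₃' a₀ a₁, ZrOfRecord₁₃ F N (theta13OfThm1CCMW F N j γ ε₀ ε₂₉ B₃ B₃' a₀ a₁)⟩) P k :=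
  fun _ _ => ⟨1, one_pos, fun _ _ _ _ _ P _ _ _ _ _ _ _ _ k hk hS => hT P k hk hS⟩

/-- **★ N11's TYPE `h11` AT THE WITNESS FROM [III]'s THEOREM OF p. 245 AS PRINTED** — for ANY family `T P` of renormalization transformations on each run's lattices (the cell's carrier `RTOpI`
along the averaging of record) AGREEING WITH THE TOWER OF RECORD on the trajectory (`hT : (T P k).T ρ_k = 𝐓ρ_k`, `k < K`), the typed sentence `B14.ThmP245PrintedI (T P) ρ S Scorr P.K` at
`ρ := densOfRecord₁₃ θ₁₅ᶜᶜᴹᵂ P` and the Stage-13 spaces of record `(VOfRecord₁₃CoPH θᴴ P).S ∕ .Scorr` (`h245`) IS `∀ k < K, SLaw → TLaw` (dag-n11's `thmP245PrintedI_at_record₁₃CoPH_iff_laws`),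
hence N11's TYPE.  CONDITIONAL; N11 NOT discharged; K1⁷ NOT closed. [cite: Balaban1988Convergent, Theorem p.245, Thm 1 p.262, remark p.262, (3.24)–(3.25) p.270; Balaban1989LargeFieldII, Thm 1 p.355 (bookkeeping)] -/
theorem N24_h11_theta13OfThm1CCMW_of_thmP245PrintedI {j c : ℕ} {γ ε₀ ε₂₉ B₃ B₃' a₀ a₁ : ℝ} (hγ₀ : 0 < γ) (hγh : γ ≤ 1 / 2)
    (hε : 0 < ε₀) (hε' : 0 < ε₂₉) (hB : 0 ≤ B₃) (hB' : 0 ≤ B₃') (ha₀ : 0 < a₀) (ha₁ : 0 < a₁)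
    (h15 : VariationalThm1RegSepCoP7M F N B₃ a₀ a₁) (hc : c ≤ F.L ^ j)
    (h9 : Gauge9RegSepTopStepR F N (fun ν K Ω => suppDomOfRecord F ν K Ω) (F.L ^ j) c B₃ B₃' a₀ a₁)
    {bl β' : ℝ} (hbox : BetaLowerH bl γ (betaOfRecord₁₃ F N (theta13OfThm1CCMW F N j γ ε₀ ε₂₉ B₃ B₃' a₀ a₁)))
    (hbox' : BetaUpperH β' γ (betaOfRecord₁₃ F N (theta13OfThm1CCMW F N j γ ε₀ ε₂₉ B₃ B₃' a₀ a₁))) (hl : -bl * γ ^ 2 ≤ 3) (hβ' : β' * γ ^ 2 ≤ 3 / 4)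
    (T : (P : B12.RunParams) → (k : ℕ) → RTOpI (F.P P.K) k (SU N) (avOfRecord F N P.K k))
    (hT : ∀ (P : B12.RunParams) (k : ℕ), k < P.K → (T P k).T (densOfRecord₁₃ F N (theta13OfThm1CCMW F N j γ ε₀ ε₂₉ B₃ B₃' a₀ a₁) P k) = tdensOfRecord₁₃ F N (theta13OfThm1CCMW F N j γ ε₀ ε₂₉ B₃ B₃' a₀ a₁) P k)
    (h245 : ∀ P : B12.RunParams, B14.ThmP245PrintedI (T P) (densOfRecord₁₃ F N (theta13OfThm1CCMW F N j γ ε₀ ε₂₉ B₃ B₃' a₀ a₁) P) (VOfRecord₁₃CoPH F N (Stage13HParams.ofHistoryBlind F N ⟨theta13OfThm1CCMW F N j γ ε₀ ε₂₉ B₃ B₃' a₀ a₁, ZrOfRecord₁₃ F N (theta13OfThm1CCMW F N j γ ε₀ ε₂₉ B₃ B₃' a₀ a₁)⟩) P).S (VOfRecord₁₃CoPH F N (Stage13HParams.ofHistoryBlind F N ⟨theta13OfThm1CCMW F N j γ ε₀ ε₂₉ B₃ B₃' a₀ a₁, ZrOfRecord₁₃ F N (theta13OfThm1CCMW F N j γ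 ε₀ ε₂₉ B₃ B₃' a₀ a₁)⟩) P).Scorr P.K) :
    ∀ βup β₀ : ℝ, ∃ γ₁₁ : ℝ, 0 < γ₁₁ ∧ ∀ w : WorldP, w.C = (datumOfRecord₁₃SepCoPH F N (Stage13HParams.ofHistoryBlind F N ⟨theta13OfThm1CCMW F N j γ ε₀ ε₂₉ B₃ B₃' a₀ a₁, ZrOfRecord₁₃ F N (theta13OfThm1CCMW F N j γ ε₀ ε₂₉ B₃ B₃' a₀ a₁)⟩) (N24_provisos₁₃SepCoPH_door_theta13OfThm1CCMW_of_gauge9TopStepR_of_betaBoxSignFree_allTorus hγ₀ hγh hε hε' hB hB' ha₀ ha₁ h15 hc h9 hbox hbox' hl hβ')).C →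
      w.βup = βup → w.β₀ = β₀ → w.γ ≤ γ₁₁ → ∀ P : B12.RunParams, (leavesP w P).b7 → (leavesP w P).b8 → (leavesP w P).b9 → (leavesP w P).b10 → (leavesP w P).b11 →
      (leavesP w P).smallCouplings → (leavesP w P).smallFieldInductive → (leavesP w P).flowControl →
        ∀ k, k < P.K → SLaw₁₃CoPH F N (Stage13HParams.ofHistoryBlind F N ⟨theta13OfThm1CCMW F N j γ ε₀ ε₂₉ B₃ B₃' a₀ a₁, ZrOfRecord₁₃ F N (theta13OfThm1CCMW F N j γ ε₀ ε₂₉ B₃ B₃' a₀ a₁)⟩) P k → TLaw₁₃CoPH F N (Stage13HParams.ofHistoryBlind F N ⟨theta13OfThm1CCMW F N j γ ε₀ ε₂₉ B₃ B₃' a₀ a₁, ZrOfRecord₁₃ F N (theta13OfThm1CCMW F N j γ ε₀ ε₂₉ B₃ B₃' a₀ a₁)⟩) P k :=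
  fun _ _ => ⟨1, one_pos, fun _ _ _ _ _ P _ _ _ _ _ _ _ _ =>
    (thmP245PrintedI_at_record₁₃CoPH_iff_laws F N (Stage13HParams.ofHistoryBlind F N ⟨theta13OfThm1CCMW F N j γ ε₀ ε₂₉ B₃ B₃' a₀ a₁, ZrOfRecord₁₃ F N (theta13OfThm1CCMW F N j γ ε₀ ε₂₉ B₃ B₃' a₀ a₁)⟩) P (T P) (hT P)).1 (h245 P)⟩

/-! ## §3–§4. N13's TYPE `hUV` from dag-n13-w1's two sockets of record -/

/-- **★ N13's TYPE `hUV` OF THE SPLIT CLOSERS AT THE WITNESS, SUPPLIED BY dag-n13-w1's DEPTH-BLIND SOCKET** `N13UVRowOfU1U2L2SmallLocus.hUV₁₃CoPH_of_U1_U2_L2small` (p597573), ONE application at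
`(θ₁₅ᶜᶜᴹᵂ-door, w₁₃)`: `γ₁₃ := w₁₃.γ`, `em := w₁₃.em`, `ep := w₁₃.ep`.  Displayed = N13's located list VERBATIM at the witness: the [Av]-range numerics `hε3 hε2` on `a₀`, the majorant
family `major`, the small-locus section `s₀`, and Cor. 3's leaves (U1) `hU1`, (U2) `hU2`, (L2ˢ) `hL2small` at `w₁₃`'s window and exponents.  CONDITIONAL; N13 NOT discharged; K1⁷ NOT closed. [cite: Balaban1988Convergent, Cor. 3 (2.50) p.264, (2.18) p.257, Thm 1 p.262, (3.16) p.268, (3.21) p.269; Balaban1989LargeFieldII, Thm 1 p.355, (0.1) pp.355–356; Balaban1985RegularSpaces, (3.42) transfer (G-adv3-1); Balaban1985Averaging, Prop. 2 (54) p.26; Balaban1987RG1, (2.9) p.266 (bookkeeping)] -/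
theorem N24_hUV_theta13OfThm1CCMW_of_n13U1U2L2small {j c : ℕ} {γ ε₀ ε₂₉ B₃ B₃' a₀ a₁ : ℝ} (hγ₀ : 0 < γ) (hγh : γ ≤ 1 / 2)
    (hε : 0 < ε₀) (hε' : 0 < ε₂₉) (hB : 0 ≤ B₃) (hB' : 0 ≤ B₃') (ha₀ : 0 < a₀) (ha₁ : 0 < a₁)
    (h15 : VariationalThm1RegSepCoP7M F N B₃ a₀ a₁) (hc : c ≤ F.L ^ j)
    (h9 : Gauge9RegSepTopStepR F N (fun ν K Ω => suppDomOfRecord F ν K Ω) (F.L ^ j) c B₃ B₃' a₀ a₁)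
    {bl β' : ℝ} (hbox : BetaLowerH bl γ (betaOfRecord₁₃ F N (theta13OfThm1CCMW F N j γ ε₀ ε₂₉ B₃ B₃' a₀ a₁)))
    (hbox' : BetaUpperH β' γ (betaOfRecord₁₃ F N (theta13OfThm1CCMW F N j γ ε₀ ε₂₉ B₃ B₃' a₀ a₁))) (hl : -bl * γ ^ 2 ≤ 3) (hβ' : β' * γ ^ 2 ≤ 3 / 4)
    (w₁₃ : WorldP) (hγ₁₃ : 0 < w₁₃.γ)
    (hε3 : (143 * ((((4 + 4 : ℕ) : ℝ)) ^ 2 / 4) ^ 2) * (theta13OfThm1CCMW F N j γ ε₀ ε₂₉ B₃ B₃' a₀ a₁).ν.εreg ≤ 1 / 3)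
    (hε2 : 2 * (theta13OfThm1CCMW F N j γ ε₀ ε₂₉ B₃ B₃' a₀ a₁).ν.εreg ≤ 2 * deltaSU (Fin N) / ((((4 + 4) * F.L : ℕ) : ℝ) ^ 2))
    (major : (P : B12.RunParams) → (k : ℕ) → (reprOfRecord₁₃ F N (theta13OfThm1CCMW F N j γ ε₀ ε₂₉ B₃ B₃' a₀ a₁) P k).Adm → ℝ)
    (s₀ : (P : B12.RunParams) → (k : ℕ) → (reprOfRecord₁₃ F N (theta13OfThm1CCMW F N j γ ε₀ ε₂₉ B₃ B₃' a₀ a₁) P k).Adm)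
    (hU1 : ∀ P : B12.RunParams, (genFlow (betaOfRecord₁₃ F N (theta13OfThm1CCMW F N j γ ε₀ ε₂₉ B₃ B₃' a₀ a₁)) P.g0).InInterval w₁₃.γ P.K → ∀ k, k ≤ P.K → SLaw₁₃CoPH F N (Stage13HParams.ofHistoryBlind F N ⟨theta13OfThm1CCMW F N j γ ε₀ ε₂₉ B₃ B₃' a₀ a₁, ZrOfRecord₁₃ F N (theta13OfThm1CCMW F N j γ ε₀ ε₂₉ B₃ B₃' a₀ a₁)⟩) P k →
      ∀ s V, (reprOfRecord₁₃ F N (theta13OfThm1CCMW F N j γ ε₀ ε₂₉ B₃ B₃' a₀ a₁) P k).χ s V * (reprOfRecord₁₃ F N (theta13OfThm1CCMW F N j γ ε₀ ε₂₉ B₃ B₃' a₀ a₁) P k).TexpA s V ≤ major P k s)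
    (hU2 : ∀ P : B12.RunParams, (genFlow (betaOfRecord₁₃ F N (theta13OfThm1CCMW F N j γ ε₀ ε₂₉ B₃ B₃' a₀ a₁)) P.g0).InInterval w₁₃.γ P.K → ∀ k, k ≤ P.K → SLaw₁₃CoPH F N (Stage13HParams.ofHistoryBlind F N ⟨theta13OfThm1CCMW F N j γ ε₀ ε₂₉ B₃ B₃' a₀ a₁, ZrOfRecord₁₃ F N (theta13OfThm1CCMW F N j γ ε₀ ε₂₉ B₃ B₃' a₀ a₁)⟩) P k →
      ∑ s, major P k s ≤ Real.exp (w₁₃.ep (gOfRecord₁₃ F N (theta13OfThm1CCMW F N j γ ε₀ ε₂₉ B₃ B₃' a₀ a₁) P k) * (Fintype.card (Site (F.P P.K) k) : ℝ)))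
    (hL2small : ∀ P : B12.RunParams, (genFlow (betaOfRecord₁₃ F N (theta13OfThm1CCMW F N j γ ε₀ ε₂₉ B₃ B₃' a₀ a₁)) P.g0).InInterval w₁₃.γ P.K → ∀ k, k ≤ P.K → SLaw₁₃CoPH F N (Stage13HParams.ofHistoryBlind F N ⟨theta13OfThm1CCMW F N j γ ε₀ ε₂₉ B₃ B₃' a₀ a₁, ZrOfRecord₁₃ F N (theta13OfThm1CCMW F N j γ ε₀ ε₂₉ B₃ B₃' a₀ a₁)⟩) P k →
      ∀ V : GaugeField (F.P P.K) k (SU N),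
        (∀ p : Plaq (F.P P.K) k, ¬ IsB0 (F := F) (⟨p.src, p.μ⟩ : PBond (F.P P.K) k) → ¬ IsB0 (F := F) (⟨p.src.shift p.μ, p.ν⟩ : PBond (F.P P.K) k) →
          ¬ IsB0 (F := F) (⟨p.src.shift p.ν, p.μ⟩ : PBond (F.P P.K) k) → ¬ IsB0 (F := F) (⟨p.src, p.ν⟩ : PBond (F.P P.K) k) →
          dist1 (GaugeField.plaqHol V p) < 2 * (theta13OfThm1CCMW F N j γ ε₀ ε₂₉ B₃ B₃' a₀ a₁).ν.εreg + 4 * (theta13OfThm1CCMW F N j γ ε₀ ε₂₉ B₃ B₃' a₀ a₁).ε₂₉) →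
        chiβOfRecord₁₃ F N (theta13OfThm1CCMW F N j γ ε₀ ε₂₉ B₃ B₃' a₀ a₁) P.K (gOfRecord₁₃ F N (theta13OfThm1CCMW F N j γ ε₀ ε₂₉ B₃ B₃' a₀ a₁) P) k V *
            Real.exp (-(1 / (gOfRecord₁₃ F N (theta13OfThm1CCMW F N j γ ε₀ ε₂₉ B₃ B₃' a₀ a₁) P k) ^ 2 * wilsonBGOfRecord F N (theta13OfThm1CCMW F N j γ ε₀ ε₂₉ B₃ B₃' a₀ a₁).εbg P k V)
              - w₁₃.em (gOfRecord₁₃ F N (theta13OfThm1CCMW F N j γ ε₀ ε₂₉ B₃ B₃' a₀ a₁) P k) * (Fintype.card (Site (F.P P.K) k) : ℝ)) ≤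
          (reprOfRecord₁₃ F N (theta13OfThm1CCMW F N j γ ε₀ ε₂₉ B₃ B₃' a₀ a₁) P k).χ (s₀ P k) V * (reprOfRecord₁₃ F N (theta13OfThm1CCMW F N j γ ε₀ ε₂₉ B₃ B₃' a₀ a₁) P k).TexpA (s₀ P k) V) :
    ∃ γ₁₃ : ℝ, 0 < γ₁₃ ∧ ∃ em ep : ℝ → ℝ, ∀ P : B12.RunParams, (genFlow (betaOfRecord₁₃ F N (theta13OfThm1CCMW F N j γ ε₀ ε₂₉ B₃ B₃' a₀ a₁)) P.g0).InInterval γ₁₃ P.K → ∀ k, k ≤ P.K → SLaw₁₃CoPH F N (Stage13HParams.ofHistoryBlind F N ⟨theta13OfThm1CCMW F N j γ ε₀ ε₂₉ B₃ B₃' a₀ a₁, ZrOfRecord₁₃ F N (theta13OfThm1CCMW F N j γ ε₀ ε₂₉ B₃ B₃' a₀ a₁)⟩) P k →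
      ∀ U : GaugeField (F.P P.K) k (SU N),
        chiβOfRecord₁₃ F N (theta13OfThm1CCMW F N j γ ε₀ ε₂₉ B₃ B₃' a₀ a₁) P.K (gOfRecord₁₃ F N (theta13OfThm1CCMW F N j γ ε₀ ε₂₉ B₃ B₃' a₀ a₁) P) k U *
              Real.exp (-(1 / (gOfRecord₁₃ F N (theta13OfThm1CCMW F N j γ ε₀ ε₂₉ B₃ B₃' a₀ a₁) P k) ^ 2 * wilsonBGOfRecord F N (theta13OfThm1CCMW F N j γ ε₀ ε₂₉ B₃ B₃' a₀ a₁).εbg P k U)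
                - em (gOfRecord₁₃ F N (theta13OfThm1CCMW F N j γ ε₀ ε₂₉ B₃ B₃' a₀ a₁) P k) * (Fintype.card (Site (F.P P.K) k) : ℝ)) ≤ densOfRecord₁₃ F N (theta13OfThm1CCMW F N j γ ε₀ ε₂₉ B₃ B₃' a₀ a₁) P k U ∧
        densOfRecord₁₃ F N (theta13OfThm1CCMW F N j γ ε₀ ε₂₉ B₃ B₃' a₀ a₁) P k U ≤ Real.exp (ep (gOfRecord₁₃ F N (theta13OfThm1CCMW F N j γ ε₀ ε₂₉ B₃ B₃' a₀ a₁) P k) * (Fintype.card (Site (F.P P.K) k) : ℝ)) :=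
  ⟨w₁₃.γ, hγ₁₃, w₁₃.em, w₁₃.ep, hUV₁₃CoPH_of_U1_U2_L2small (Stage13HParams.ofHistoryBlind F N ⟨theta13OfThm1CCMW F N j γ ε₀ ε₂₉ B₃ B₃' a₀ a₁, ZrOfRecord₁₃ F N (theta13OfThm1CCMW F N j γ ε₀ ε₂₉ B₃ B₃' a₀ a₁)⟩)
    (N24_provisos₁₃SepCoPH_door_theta13OfThm1CCMW_of_gauge9TopStepR_of_betaBoxSignFree_allTorus hγ₀ hγh hε hε' hB hB' ha₀ ha₁ h15 hc h9 hbox hbox' hl hβ').toCore w₁₃ ha₀ hε3 hε2 major s₀ hU1 hU2 hL2small⟩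

/-- **★ N13's TYPE `hUV` AT THE WITNESS, SUPPLIED BY dag-n13-w1's DEPTH-INDEXED SOCKET** `N13Cor3AtRecordOfDepthIndexedLeaves.hUV₁₃CoPH_of_U1_U2_L2small_depthIndexed` (p601572), ONE application at
`(θ₁₅ᶜᶜᴹᵂ-door, w₁₃)`.  Displayed additionally: NODE O's floor at `w₁₃`'s letters `hlo : BetaLowerH w₁₃.b w₁₃.γ (β₁₃ θ₁₅ᶜᶜᴹᵂ)` (on Part 23's road = `hO` at `(b, γO) := (w₁₃.b, w₁₃.γ)`), the
depth-indexed budgets `Em Ep` and their domination `hem hep` by `w₁₃.em ∕ w₁₃.ep` while `(K−k)·b < g_k⁻²`; (U1), (U2) with `Ep (g_k) (K−k)`, (L2ˢ) with `Em (g_k) (K−k)`.  CONDITIONAL; N13 NOT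
discharged; K1⁷ NOT closed. [cite: Balaban1988Convergent, Cor. 3 (2.50) p.264, (2.18) p.257, Thm 1 p.262, (3.16) p.268, (3.21) p.269; Balaban1989LargeFieldII, Thm 1 p.355, (0.1) pp.355–356; Balaban1985RegularSpaces, (3.42) transfer (G-adv3-1); Balaban1985Averaging, Prop. 2 (54) p.26; Balaban1987RG1, (2.9) p.266 (bookkeeping)] -/
theorem N24_hUV_theta13OfThm1CCMW_of_n13U1U2L2small_depthIndexed {j c : ℕ} {γ ε₀ ε₂₉ B₃ B₃' a₀ a₁ : ℝ} (hγ₀ : 0 < γ) (hγh : γ ≤ 1 / 2)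
    (hε : 0 < ε₀) (hε' : 0 < ε₂₉) (hB : 0 ≤ B₃) (hB' : 0 ≤ B₃') (ha₀ : 0 < a₀) (ha₁ : 0 < a₁)
    (h15 : VariationalThm1RegSepCoP7M F N B₃ a₀ a₁) (hc : c ≤ F.L ^ j)
    (h9 : Gauge9RegSepTopStepR F N (fun ν K Ω => suppDomOfRecord F ν K Ω) (F.L ^ j) c B₃ B₃' a₀ a₁)
    {bl β' : ℝ} (hbox : BetaLowerH bl γ (betaOfRecord₁₃ F N (theta13OfThm1CCMW F N j γ ε₀ ε₂₉ B₃ B₃' a₀ a₁)))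
    (hbox' : BetaUpperH β' γ (betaOfRecord₁₃ F N (theta13OfThm1CCMW F N j γ ε₀ ε₂₉ B₃ B₃' a₀ a₁))) (hl : -bl * γ ^ 2 ≤ 3) (hβ' : β' * γ ^ 2 ≤ 3 / 4)
    (w₁₃ : WorldP) (hγ₁₃ : 0 < w₁₃.γ)
    (hε3 : (143 * ((((4 + 4 : ℕ) : ℝ)) ^ 2 / 4) ^ 2) * (theta13OfThm1CCMW F N j γ ε₀ ε₂₉ B₃ B₃' a₀ a₁).ν.εreg ≤ 1 / 3)
    (hε2 : 2 * (theta13OfThm1CCMW F N j γ ε₀ ε₂₉ B₃ B₃' a₀ a₁).ν.εreg ≤ 2 * deltaSU (Fin N) / ((((4 + 4) * F.L : ℕ) : ℝ) ^ 2))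
    (hlo : BetaLowerH w₁₃.b w₁₃.γ (betaOfRecord₁₃ F N (theta13OfThm1CCMW F N j γ ε₀ ε₂₉ B₃ B₃' a₀ a₁)))
    (Em Ep : ℝ → ℕ → ℝ)
    (hem : ∀ x : ℝ, 0 < x → ∀ n : ℕ, (n : ℝ) * w₁₃.b < (x ^ 2)⁻¹ → Em x n ≤ w₁₃.em x)
    (hep : ∀ x : ℝ, 0 < x → ∀ n : ℕ, (n : ℝ) * w₁₃.b < (x ^ 2)⁻¹ → Ep x n ≤ w₁₃.ep x)
    (major : (P : B12.RunParams) → (k : ℕ) → (reprOfRecord₁₃ F N (theta13OfThm1CCMW F N j γ ε₀ ε₂₉ B₃ B₃' a₀ a₁) P k).Adm → ℝ)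
    (s₀ : (P : B12.RunParams) → (k : ℕ) → (reprOfRecord₁₃ F N (theta13OfThm1CCMW F N j γ ε₀ ε₂₉ B₃ B₃' a₀ a₁) P k).Adm)
    (hU1 : ∀ P : B12.RunParams, (genFlow (betaOfRecord₁₃ F N (theta13OfThm1CCMW F N j γ ε₀ ε₂₉ B₃ B₃' a₀ a₁)) P.g0).InInterval w₁₃.γ P.K → ∀ k, k ≤ P.K → SLaw₁₃CoPH F N (Stage13HParams.ofHistoryBlind F N ⟨theta13OfThm1CCMW F N j γ ε₀ ε₂₉ B₃ B₃' a₀ a₁, ZrOfRecord₁₃ F N (theta13OfThm1CCMW F N j γ ε₀ ε₂₉ B₃ B₃' a₀ a₁)⟩) P k →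
      ∀ s V, (reprOfRecord₁₃ F N (theta13OfThm1CCMW F N j γ ε₀ ε₂₉ B₃ B₃' a₀ a₁) P k).χ s V * (reprOfRecord₁₃ F N (theta13OfThm1CCMW F N j γ ε₀ ε₂₉ B₃ B₃' a₀ a₁) P k).TexpA s V ≤ major P k s)
    (hU2 : ∀ P : B12.RunParams, (genFlow (betaOfRecord₁₃ F N (theta13OfThm1CCMW F N j γ ε₀ ε₂₉ B₃ B₃' a₀ a₁)) P.g0).InInterval w₁₃.γ P.K → ∀ k, k ≤ P.K → SLaw₁₃CoPH F N (Stage13HParams.ofHistoryBlind F N ⟨theta13OfThm1CCMW F N j γ ε₀ ε₂₉ B₃ B₃' a₀ a₁, ZrOfRecord₁₃ F N (theta13OfThm1CCMW F N j γ ε₀ ε₂₉ B₃ B₃' a₀ a₁)⟩) P k →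
      ∑ s, major P k s ≤ Real.exp (Ep (gOfRecord₁₃ F N (theta13OfThm1CCMW F N j γ ε₀ ε₂₉ B₃ B₃' a₀ a₁) P k) (P.K - k) * (Fintype.card (Site (F.P P.K) k) : ℝ)))
    (hL2small : ∀ P : B12.RunParams, (genFlow (betaOfRecord₁₃ F N (theta13OfThm1CCMW F N j γ ε₀ ε₂₉ B₃ B₃' a₀ a₁)) P.g0).InInterval w₁₃.γ P.K → ∀ k, k ≤ P.K → SLaw₁₃CoPH F N (Stage13HParams.ofHistoryBlind F N ⟨theta13OfThm1CCMW F N j γ ε₀ ε₂₉ B₃ B₃' a₀ a₁, ZrOfRecord₁₃ F N (theta13OfThm1CCMW F N j γ ε₀ ε₂₉ B₃ B₃' a₀ a₁)⟩) P k →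
      ∀ V : GaugeField (F.P P.K) k (SU N),
        (∀ p : Plaq (F.P P.K) k, ¬ IsB0 (F := F) (⟨p.src, p.μ⟩ : PBond (F.P P.K) k) → ¬ IsB0 (F := F) (⟨p.src.shift p.μ, p.ν⟩ : PBond (F.P P.K) k) →
          ¬ IsB0 (F := F) (⟨p.src.shift p.ν, p.μ⟩ : PBond (F.P P.K) k) → ¬ IsB0 (F := F) (⟨p.src, p.ν⟩ : PBond (F.P P.K) k) →
          dist1 (GaugeField.plaqHol V p) < 2 * (theta13OfThm1CCMW F N j γ ε₀ ε₂₉ B₃ B₃' a₀ a₁).ν.εreg + 4 * (theta13OfThm1CCMW F N j γ ε₀ ε₂₉ B₃ B₃' a₀ a₁).ε₂₉) →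
        chiβOfRecord₁₃ F N (theta13OfThm1CCMW F N j γ ε₀ ε₂₉ B₃ B₃' a₀ a₁) P.K (gOfRecord₁₃ F N (theta13OfThm1CCMW F N j γ ε₀ ε₂₉ B₃ B₃' a₀ a₁) P) k V *
            Real.exp (-(1 / (gOfRecord₁₃ F N (theta13OfThm1CCMW F N j γ ε₀ ε₂₉ B₃ B₃' a₀ a₁) P k) ^ 2 * wilsonBGOfRecord F N (theta13OfThm1CCMW F N j γ ε₀ ε₂₉ B₃ B₃' a₀ a₁).εbg P k V)
              - Em (gOfRecord₁₃ F N (theta13OfThm1CCMW F N j γ ε₀ ε₂₉ B₃ B₃' a₀ a₁) P k) (P.K - k) * (Fintype.card (Site (F.P P.K) k) : ℝ)) ≤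
          (reprOfRecord₁₃ F N (theta13OfThm1CCMW F N j γ ε₀ ε₂₉ B₃ B₃' a₀ a₁) P k).χ (s₀ P k) V * (reprOfRecord₁₃ F N (theta13OfThm1CCMW F N j γ ε₀ ε₂₉ B₃ B₃' a₀ a₁) P k).TexpA (s₀ P k) V) :
    ∃ γ₁₃ : ℝ, 0 < γ₁₃ ∧ ∃ em ep : ℝ → ℝ, ∀ P : B12.RunParams, (genFlow (betaOfRecord₁₃ F N (theta13OfThm1CCMW F N j γ ε₀ ε₂₉ B₃ B₃' a₀ a₁)) P.g0).InInterval γ₁₃ P.K → ∀ k, k ≤ P.K → SLaw₁₃CoPH F N (Stage13HParams.ofHistoryBlind F N ⟨theta13OfThm1CCMW F N j γ ε₀ ε₂₉ B₃ B₃' a₀ a₁, ZrOfRecord₁₃ F N (theta13OfThm1CCMW F N j γ ε₀ ε₂₉ B₃ B₃' a₀ a₁)⟩) P k →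
      ∀ U : GaugeField (F.P P.K) k (SU N),
        chiβOfRecord₁₃ F N (theta13OfThm1CCMW F N j γ ε₀ ε₂₉ B₃ B₃' a₀ a₁) P.K (gOfRecord₁₃ F N (theta13OfThm1CCMW F N j γ ε₀ ε₂₉ B₃ B₃' a₀ a₁) P) k U *
              Real.exp (-(1 / (gOfRecord₁₃ F N (theta13OfThm1CCMW F N j γ ε₀ ε₂₉ B₃ B₃' a₀ a₁) P k) ^ 2 * wilsonBGOfRecord F N (theta13OfThm1CCMW F N j γ ε₀ ε₂₉ B₃ B₃' a₀ a₁).εbg P k U)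
                - em (gOfRecord₁₃ F N (theta13OfThm1CCMW F N j γ ε₀ ε₂₉ B₃ B₃' a₀ a₁) P k) * (Fintype.card (Site (F.P P.K) k) : ℝ)) ≤ densOfRecord₁₃ F N (theta13OfThm1CCMW F N j γ ε₀ ε₂₉ B₃ B₃' a₀ a₁) P k U ∧
        densOfRecord₁₃ F N (theta13OfThm1CCMW F N j γ ε₀ ε₂₉ B₃ B₃' a₀ a₁) P k U ≤ Real.exp (ep (gOfRecord₁₃ F N (theta13OfThm1CCMW F N j γ ε₀ ε₂₉ B₃ B₃' a₀ a₁) P k) * (Fintype.card (Site (F.P P.K) k) : ℝ)) :=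
  ⟨w₁₃.γ, hγ₁₃, w₁₃.em, w₁₃.ep, hUV₁₃CoPH_of_U1_U2_L2small_depthIndexed (Stage13HParams.ofHistoryBlind F N ⟨theta13OfThm1CCMW F N j γ ε₀ ε₂₉ B₃ B₃' a₀ a₁, ZrOfRecord₁₃ F N (theta13OfThm1CCMW F N j γ ε₀ ε₂₉ B₃ B₃' a₀ a₁)⟩)
    (N24_provisos₁₃SepCoPH_door_theta13OfThm1CCMW_of_gauge9TopStepR_of_betaBoxSignFree_allTorus hγ₀ hγh hε hε' hB hB' ha₀ ha₁ h15 hc h9 hbox hbox' hl hβ').toCore w₁₃ ha₀ hε3 hε2 hlo Em Ep hem hep major s₀ hU1 hU2 hL2small⟩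

/-! ## §5. N07's TYPE `h07` (θ-FREE) from dag-n07's existence theorem at print's own radius -/

/-- **★ N07's TYPE `h07 : ∃ ζ, B11Leaf (Z11OfRecord F N ζ)` OF THE SPLIT CLOSERS, SUPPLIED BY dag-n07's EXISTENCE THEOREM AT PRINT's RADIUS**
`N07ExistenceFromProp8AtRadius.b11Leaf_Z11OfRecord_pinCrit_of_parts_atMostOne_prop8At_avoidanceAt` — the [B11] leaf of record at the PINNED-CRITICAL layer `ζ.pinCrit` of ANY residual `ζ`
from Props 2–6 and 9 (`p2 p3 p4 p5 p6 p9`), Prop. 7's uniqueness sentence (`huniq`), Prop. 8 read as an object sentence at its radius `a₅` (`hP8`), Sect. F (`sF`), boundary avoidance at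
`ε₀ = a₅` (`hav`) and the numerics `7 ≤ B₃`, `0 < C₁`, `0 < a₀`, `0 < a₁`, `L³·B₃·a₁ ≤ a₅ < α₀`, the two [B7]-type bounds on `α₀` — displayed VERBATIM (θ-free, door-free; general `N`).
CONDITIONAL; N07 NOT discharged; K1⁷ NOT closed. [cite: Balaban1985Variational, Thm 1 p.279, Props 2–9 pp.281–309, (6), (8)–(10) p.279, Sect. F; Balaban1989LargeFieldII, Thm 1 p.355 (bookkeeping)] -/
theorem N24_h07_of_n07Parts_atMostOne_prop8At_avoidanceAt (ζ : ResidZ F N) (hB₃ : 7 ≤ ζ.B₃) (hC₁ : 0 < ζ.C₁) {a₀ a₁ a₅ α₀ : ℝ}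
    (ha₀ : 0 < a₀) (ha₁ : 0 < a₁) (ha₅ : (F.L : ℝ) ^ 3 * ζ.B₃ * a₁ ≤ a₅) (he : a₅ < α₀) (hα : 0 < α₀)
    (hα3 : (143 * ((((4 + 4 : ℕ) : ℝ)) ^ 2 / 4) ^ 2) * α₀ ≤ 1 / 3)
    (hα2 : 2 * α₀ ≤ 2 * deltaSU (Fin N) / (((4 + 4) * F.L : ℕ) : ℝ) ^ 2)
    (p2 : B11.Prop2Printed ζ.B₁ ζ.B₃ ζ.C₁ ζ.c₁ ζ.famLG) (p3 : B11.Prop3Printed ζ.C₁ ζ.B₃ ζ.C₂ ζ.C₃ ζ.B₀ ζ.c1h ζ.c₄ ζ.δ₀ ζ.famLG)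
    (p4 : B11.Prop4Printed ζ.C₁ ζ.B₃ ζ.famLG) (p5 : B11.Prop5Printed ζ.B₁ ζ.B₃ ζ.C₁ ζ.famLG) (p6 : B11.Prop6Printed ζ.B₀ ζ.B₃ ζ.C₁ ζ.famLG)
    (huniq : ∀ (i : ZIdx) (ε₀ ε₁ : ℝ), 0 < ε₁ → ∀ V : GaugeField (F.P i.K) i.k (SU N), PlaqSmall ε₁ V → ε₀ ≤ a₀ → ζ.B₃ * ε₁ ≤ ε₀ →
      (famXOfRecord F N ζ.pinCrit i).AtMostOneCriticalOrbit ε₀ V)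
    (hP8 : ∀ (i : ZIdx) (ε₁ : ℝ), 0 < ε₁ → ∀ (V : GaugeField (F.P i.K) i.k (SU N)) (U : GaugeField (F.P i.K) 0 (SU N)), PlaqSmall ε₁ V →
      InUkClassB11 F N i.K i.k a₅ U → Averaging.iter (avOfRecord F N i.K) i.k U = V → IsCritOfRecord F N i.K i.k V U →
        InUkClassB11 F N i.K i.k (ζ.B₃ * ε₁) U)
    (sF : B11.SectFPrinted ζ.B₃ (famXOfRecord F N ζ.pinCrit)) (p9 : B11.Prop9Printed ζ.B₅ ζ.C₁ ζ.β₀ ζ.δ₀ ζ.famAn)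
    (hav : ∀ (i : ZIdx) (ε₁ : ℝ), 0 < ε₁ → ε₁ ≤ a₁ → ∀ V : GaugeField (F.P i.K) i.k (SU N), PlaqSmall ε₁ V →
      ∀ U₀ : GaugeField (F.P i.K) 0 (SU N),
        IsBackground (avOfRecord F N i.K) (closure {U | InUkClassB11 F N i.K i.k a₅ U}) i.k V U₀ → InUkClassB11 F N i.K i.k a₅ U₀) :
    ∃ ζ' : ResidZ F N, B11Leaf (Z11OfRecord F N ζ') :=
  ⟨ζ.pinCrit, b11Leaf_Z11OfRecord_pinCrit_of_parts_atMostOne_prop8At_avoidanceAt ζ hB₃ hC₁ ha₀ ha₁ ha₅ he hα hα3 hα2 p2 p3 p4 p5 p6 huniq hP8 sF p9 hav⟩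

end Summit.QuantumFields.YangMills.BalabanUVNodes.N24ChildrenSplitN07N11N13Suppliers

end
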